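import Mathlib
import Literature.MathematicalPhysics.QuantumFieldTheory.Balaban1983to89.T4AveragingDeficit
import Literature.MathematicalPhysics.QuantumFieldTheory.Balaban1983to89.T4ConvexResponse
import Literature.MathematicalPhysics.QuantumFieldTheory.Balaban1983to89.Beta.FluctuationProjection

/-!
# T4AveragingDeficitBridge — the lineage's typed wall `T4ConvexResponse.DefectDerivBound` INHABITED BY THE ABELIAN MODEL WITH RATE: the first variation of the one-step deficit of `T4AveragingDeficit` as a real-linear functional, its `HasDerivAt` certificate, and `DefectDerivBound (curvature-regular set) (D deficit) (fine energy norm) (2√(6(d+2))·n²·K)`; v1.1: with the β sub-cell's explicit right inverse of the block average (`Beta.FluctuationProjection.Jlift`, `Q ∘ J = id`, reused), the lineage's second typed shape `T4ConvexResponse.TangentLift` INHABITED (`Λ = 4n(n^{d+2})^{1/2}`), and the wall's consumer `dualResidual_le` (R2ᴱ) INSTANTIATED END TO END in the abelian model (cell `pub-balaban`, T4-DAG node U1 (b), spine estimate NE3, row T4-U1b.NE3-PROVE-P2d*; [folklore] glue between two tree leaves)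

HONEST FRAMING (cell `pub-balaban`, T4-DAG PAGE 1).  The cell's T4 target is the existence AND uniqueness of the
continuum limit of Bałaban's unit-scale averaged loop expectations on a FINITE torus T⁴ — strictly beyond ultraviolet
stability; NO mass gap statement, NOT the Clay problem, NOT summit progress.  This file is GLUE of the NE3
energy-convexity seat (P2): it imports the seat's two leaves — `T4ConvexResponse` (where the route's MISSING INEQUALITY
β is TYPED as the hypothesis shape `DefectDerivBound crit d𝓓 normF δ := ∀ u ∈ crit, ∀ ψ, |d𝓓 u ψ| ≤ δ · normF ψ`,
never used as a fact) and `T4AveragingDeficit` (the one-step abelian deficit of the typed linear average `QvOp`,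
B5 (1.18), with its polarisation and stencil Poincaré bounds) — and proves that the typed shape is INHABITED, with the
intended RATE, by the abelian model: for every plane `(μ, ν)` and level `K ≥ 0`, on the set of fields whose plaquette
field has one-difference energy `Σ_κ E_κ(plaq A) ≤ K²`, the derivative functional `ψ ↦ D deficit(A)[ψ] = 2B(A, ψ)`
satisfies `DefectDerivBound` with `normF ψ = n (Σ_x ‖plaq ψ‖²)^{1/2}` and `δ = 2√(6(d+2)) · n² · K`.  In the units
of the record (§0 (l)): `δ = √(6(d+2)) · ξ_c · ‖∇^{ξ_f}F‖_{L²}` against `‖d^{ξ_f}ψ‖_{L²}` (the kernel's factor `2` of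
`dDeficit = 2B` is absorbed by the `½` of the action normalisation `S^ξ = ½ Σ ξ^d ‖…‖²` of the dictionary,
`T4AveragingDeficit` header l.333–334; referee C-t4r3-21) — ONE COARSE SPACING, the
`δ_k ∝ η` of the wall's intended reading, for the LINEAR average.  NE3 and the cell's conditionals (BetaPertH, (B),
(B^μ)) are not mentioned; nothing is asserted about Bałaban's non-linear average (15), his minimisers or operators:
that `U_{k+1}(V)` lies in such a curvature-regular set is printed-TYPE regularity ((9)ˢᵘᵖ + (10) p. 279 read in L²,
record (3.8)) and is NOT asserted here, and β for Bałaban's `𝓓` remains [analysis] (record Appendix β; GAPS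
G-ne3p2-1, whose REMAINING part is the non-abelian layer).  Value = the seat's typing closes on itself: the wall's
linear layer is a theorem about the tree's operator, in the wall's own vocabulary; NOT summit progress.

CITATION HEADER (lean-in-tree rule 2026-08-18).  No sentence of any paper is used.  Context only: T. Bałaban,
*Propagators and renormalization transformations for lattice gauge theories. I*, Commun. Math. Phys. **95** (1984)
17–40 [Balaban1984PropagatorsI] («B5»; (1.18) p. 20 the average `Q_k` = tree `QvOp`; (1.4) p. 18, (1.20) p. 20 gauge
covariance = tree `QvOp_gaugeT_eq`); P. Federbush, Commun. Math. Phys. **107** (1986) 319–329 [Federbush1986PhaseCellI]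
((0.12) p. 321, the inequality whose deficit `T4AveragingDeficit` computes); T. Bałaban, Commun. Math. Phys. **102**
(1985) 277–309 [Balaban1985Variational] («B11»; Thm 1 (9)–(10) p. 279 — the printed TYPE of regularity that the set
`critSet` models; (26)–(27) p. 282 — the residual that `DefectDerivBound` feeds in `T4ConvexResponse.dualResidual_le`).
[cite: Balaban1984PropagatorsI, (1.18) p. 20, (1.4) p. 18, (1.20) p. 20 (definitions); Federbush1986PhaseCellI, (0.12)
p. 321 (context); Balaban1985Variational, (9)–(10) p. 279, (26)–(27) p. 282 (context only)]

WHAT IS PROVED (all [folklore], sorry-free).  §1 `plaq_add`, `plaq_real_smul`, `real_smul_eq`, `bil_add_right`,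
`bil_smul_right`, `bil_comm` (the polar form of `T4AveragingDeficit` is real-bilinear and symmetric).  §2 `dDeficit μ ν A :
(fields) →ₗ[ℝ] ℝ`, `dDeficit_apply` (`= 2B(A, ·)`), `hasDerivAt_deficit` (`HasDerivAt (s ↦ deficit(A + sψ)) (dDeficit A ψ) 0`
— from the exact polynomial identity `deficit_add_smul`; the derivative is a genuine derivative, not a definition).  §3
`fineNorm`, `critSet`, `zero_mem_critSet`.  §4 `defectDerivBound_abelianModel` (the instantiation, from
`T4AveragingDeficit.abs_bil_le_dE`), `abs_deficit_le_of_mem_critSet` (the value companion `|deficit A| ≤ 6(d+2)n⁴K²`,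
(β′) in the same vocabulary), `dDeficit_gaugeT` (invariance in the field AND in the direction under `A ↦ A − ∂λ`).  v1.1 (append-only; imports the
tree's `Beta.FluctuationProjection` for the FACE-LAYER LIFT `Jlift` — `(Jφ)(x, κ) = n φ(blockOf x, κ)·[digit_κ x = n − 1]`
— and its kernel theorem `QvOp_Jlift_mulVec : Q (J φ) = φ`, an explicit right inverse of the average (1.18); nothing is
re-proved): §5 `Jlift_mulVec_bpt` (pointwise form at block points).  §6 `coarseL2`, `sum_normSq_Jlift_le`
(`Σ‖Jφ‖² ≤ n^{d+2} Σ‖φ‖²`), `normSq_plaq_le_four`, `sum_normSq_comp_le`, `sum_normSq_plaq_le` (`Σ_x‖plaq ψ‖² ≤ 16 Σ‖ψ‖²`),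
`fineNorm_Jlift_le` (`fineNorm (Jφ) ≤ 4n(n^{d+2})^{1/2} ‖φ‖_{ℓ²}`).  §7 `dQ` (the average as a real-linear map),
`tangentLift_abelianModel` (THE SECOND TYPED SHAPE `TangentLift crit T fineT dP normF N Λ` of `T4ConvexResponse`
INHABITED for every `crit`, `T`, plane, with `fineT u ψ := Q ψ ∈ T`, `dP := dQ`, `Λ = 4n(n^{d+2})^{1/2}`, witness `Jφ`),
`actC`, `actF`,
`deficit_eq_actC_sub_actF` (rfl), `dActC`, `dActF` (+ `_apply`), `hasDerivAt_actF`, `hasDerivAt_actC` (genuine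
derivatives), `dDeficit_eq_chain` (the consumer's chain rule as an identity), `defectDerivBound_mono`, and
`dualResidual_abelianModel` (+ non-vacuity `dActF_zero`): for `u ∈ critSet K` critical for `actF` among all fine directions with block average in
`T`, and `φ ∈ T`, `|D actC(Q u)[φ]| ≤ (4n(n^{d+2})^{1/2}) · (2√(6(d+2)) n² K) · ‖φ‖_{ℓ²}` — the wall's consumer
`dualResidual_le` with all four hypotheses discharged inside the package (R2ᴱ of the lineage in the abelian model).

NOT CLAIMED.  `DefectDerivBound` for Bałaban's non-linear `𝓓 = A^η∘avg − A^{η/L}` (the wall itself); membership of any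
minimiser in `critSet`; `TangentLift` for Bałaban's NON-LINEAR average (15) with his constraint and gauge conditions
(75)–(76), (83) (only the linear average `QvOp` with tangency «`Qψ ∈ T`» is treated); anything about ML, `H_k`, `𝔊`;
the units dictionary is bookkeeping (record §0 (l)), not kernel.  Record: HOME/t4/T4-EST-NE3-P2.md v1.18 §0 (m);
v1.1: record v1.19 §0 (o).
-/

set_option autoImplicit false

namespace Literature.MathematicalPhysics.QuantumFieldTheory.Balaban1983to89.T4AveragingDeficitBridge

open scoped BigOperators Matrix ComplexConjugate
open Finset Complex
open Literature.MathematicalPhysics.QuantumFieldTheory.Balaban1983to89.B5Prop11Plancherel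
open Literature.MathematicalPhysics.QuantumFieldTheory.Balaban1983to89.B5Block118
open Literature.MathematicalPhysics.QuantumFieldTheory.Balaban1983to89.B5AverageCurlStokes
open Literature.MathematicalPhysics.QuantumFieldTheory.Balaban1983to89.B5Blocks16
open Literature.MathematicalPhysics.QuantumFieldTheory.Balaban1983to89.B5Action121
open Literature.MathematicalPhysics.QuantumFieldTheory.Balaban1983to89.T4AveragingDeficit
open Literature.MathematicalPhysics.QuantumFieldTheory.Balaban1983to89.T4ConvexResponse
open Literature.MathematicalPhysics.QuantumFieldTheory.Balaban1983to89.Beta.FluctuationProjection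

noncomputable section

variable {d : ℕ} (n : ℕ) [NeZero n] (M : Fin d → ℕ) [hM : ∀ μ, NeZero (M μ)]

/-! ## §1 Linearity of the plaquette sum and of the polar form in the direction -/

omit [NeZero n] hM in
/-- `plaq` is additive in the field. [folklore] -/
theorem plaq_add {N : Fin d → ℕ} (A B : Tor N × Fin d → ℂ) (μ ν : Fin d) (x : Tor N) :
    plaq N (A + B) μ ν x = plaq N A μ ν x + plaq N B μ ν x := by
  simp only [plaq, Pi.add_apply]; ring

omit [NeZero n] hM in
/-- `plaq` is real-homogeneous in the field. [folklore] -/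
theorem plaq_real_smul {N : Fin d → ℕ} (r : ℝ) (A : Tor N × Fin d → ℂ) (μ ν : Fin d) (x : Tor N) :
    plaq N (r • A) μ ν x = (r : ℂ) * plaq N A μ ν x := by
  simp only [plaq, Pi.smul_apply, Complex.real_smul]; ring

omit [NeZero n] hM in
/-- A real scalar multiple of a field is the complex scalar multiple by the cast. [folklore] -/
theorem real_smul_eq {N : Fin d → ℕ} (r : ℝ) (A : Tor N × Fin d → ℂ) : r • A = (r : ℂ) • A := by
  funext i; simp [Complex.real_smul]

/-- The polar form `B(A, ψ)` is additive in `ψ`. [folklore] -/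
theorem bil_add_right (A ψ ψ' : Tor (fine n M) × Fin d → ℂ) (μ ν : Fin d) :
    bil n M A (ψ + ψ') μ ν = bil n M A ψ μ ν + bil n M A ψ' μ ν := by
  simp only [bil, Matrix.mulVec_add, plaq_add, rin_add_right, Finset.sum_add_distrib]
  ring

/-- The polar form `B(A, ψ)` is real-homogeneous in `ψ`. [folklore] -/
theorem bil_smul_right (r : ℝ) (A ψ : Tor (fine n M) × Fin d → ℂ) (μ ν : Fin d) :
    bil n M A (r • ψ) μ ν = r * bil n M A ψ μ ν := by
  rw [real_smul_eq]
  simp only [bil, Matrix.mulVec_smul]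
  have h1 : ∀ y, plaq M ((r : ℂ) • (QvOp n M *ᵥ ψ)) μ ν y = (r : ℂ) * plaq M (QvOp n M *ᵥ ψ) μ ν y := by
    intro y; simp only [plaq, Pi.smul_apply, smul_eq_mul]; ring
  have h2 : ∀ x, plaq (fine n M) ((r : ℂ) • ψ) μ ν x = (r : ℂ) * plaq (fine n M) ψ μ ν x := by
    intro x; simp only [plaq, Pi.smul_apply, smul_eq_mul]; ring
  simp only [h1, h2, rin_smul_right, ← Finset.mul_sum]
  ring

/-- The polar form is symmetric. [folklore] -/
theorem bil_comm (A ψ : Tor (fine n M) × Fin d → ℂ) (μ ν : Fin d) :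
    bil n M A ψ μ ν = bil n M ψ A μ ν := by
  simp only [bil]
  rw [Finset.sum_congr rfl (fun y _ => rin_comm (plaq M (QvOp n M *ᵥ A) μ ν y) (plaq M (QvOp n M *ᵥ ψ) μ ν y)),
    Finset.sum_congr rfl (fun x _ => rin_comm (plaq (fine n M) A μ ν x) (plaq (fine n M) ψ μ ν x))]

/-! ## §2 The derivative of the deficit as a linear functional -/

/-- The first variation of the one-step abelian deficit at `A` in the plane `(μ, ν)`, as a real-linear
functional of the direction: `D deficit(A)[ψ] = 2 B(A, ψ)`. [folklore] -/
def dDeficit (μ ν : Fin d) (A : Tor (fine n M) × Fin d → ℂ) : (Tor (fine n M) × Fin d → ℂ) →ₗ[ℝ] ℝ where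
  toFun ψ := 2 * bil n M A ψ μ ν
  map_add' ψ ψ' := by rw [bil_add_right]; ring
  map_smul' r ψ := by rw [bil_smul_right]; simp only [RingHom.id_apply, smul_eq_mul]; ring

/-- Unfolding lemma. [folklore] -/
theorem dDeficit_apply (μ ν : Fin d) (A ψ : Tor (fine n M) × Fin d → ℂ) :
    dDeficit n M μ ν A ψ = 2 * bil n M A ψ μ ν := rfl

/-- `dDeficit` IS the derivative: `s ↦ deficit(A + sψ)` has derivative `2 B(A, ψ)` at `s = 0` (from the exact
polarisation identity `deficit_add_smul`; no junk values — the function is a real quadratic polynomial in `s`).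
[folklore] -/
theorem hasDerivAt_deficit (μ ν : Fin d) (A ψ : Tor (fine n M) × Fin d → ℂ) :
    HasDerivAt (fun s : ℝ => deficit n M (A + (s : ℂ) • ψ) μ ν) (dDeficit n M μ ν A ψ) 0 := by
  have hfun : (fun s : ℝ => deficit n M (A + (s : ℂ) • ψ) μ ν)
      = fun s : ℝ => deficit n M A μ ν + 2 * bil n M A ψ μ ν * s + deficit n M ψ μ ν * s ^ 2 := by
    funext s; rw [deficit_add_smul]; ring
  rw [hfun, dDeficit_apply]
  have ha := (hasDerivAt_id (0 : ℝ)).const_mul (2 * bil n M A ψ μ ν)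
  have hb := (hasDerivAt_pow 2 (0 : ℝ)).const_mul (deficit n M ψ μ ν)
  have h := (ha.const_add (deficit n M A μ ν)).add hb
  simpa [Pi.add_def] using h

/-! ## §3 The fine energy-type norm and the curvature-regular set -/

/-- The fine energy-type size of a direction in the plane `(μ, ν)`: `n · (Σ_x ‖plaq ψ (x)‖²)^{1/2}`
(in units, `‖d^{ξ_f} ψ‖_{L²}` up to the fixed lattice factors of the dictionary). [folklore] -/
def fineNorm (μ ν : Fin d) (ψ : Tor (fine n M) × Fin d → ℂ) : ℝ :=
  (n : ℝ) * Real.sqrt (∑ x : Tor (fine n M), ‖plaq (fine n M) ψ μ ν x‖ ^ 2)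

/-- The CURVATURE-REGULAR fields of the plane `(μ, ν)` at level `K`: one fine-lattice difference of the plaquette
field has total energy `Σ_κ E_κ(plaq A) ≤ K²` (in units: `‖∇^{ξ_f} F_{μν}‖_{L²} ≤ K` up to the dictionary's lattice
factors — the printed-TYPE regularity of minimisers, (9)ˢᵘᵖ + (10) read in `L²`, is what places Bałaban's
`U_{k+1}(V)` in such a set; NOT asserted here). [folklore] -/
def critSet (μ ν : Fin d) (K : ℝ) : Set (Tor (fine n M) × Fin d → ℂ) :=
  {A | ∑ κ : Fin d, dE κ (plaq (fine n M) A μ ν) ≤ K ^ 2}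

/-- The curvature-regular set is non-empty at every level: the zero field lies in it. [folklore] -/
theorem zero_mem_critSet (μ ν : Fin d) (K : ℝ) : (0 : Tor (fine n M) × Fin d → ℂ) ∈ critSet n M μ ν K := by
  show ∑ κ : Fin d, dE κ (plaq (fine n M) 0 μ ν) ≤ K ^ 2
  have h0 : ∀ κ : Fin d, dE κ (plaq (fine n M) (0 : Tor (fine n M) × Fin d → ℂ) μ ν) = 0 := by
    intro κ; simp [dE, fd, plaq]
  simp only [h0, Finset.sum_const_zero]
  positivity

/-! ## §4 The typed wall `DefectDerivBound`, inhabited by the abelian model with rate -/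

/-- THE LINEAGE'S TYPED WALL IS MET BY THE ABELIAN MODEL, WITH RATE.  For every plane `(μ, ν)` and every level
`K ≥ 0`: `T4ConvexResponse.DefectDerivBound (critSet K) dDeficit fineNorm (2 √(6(d+2)) · n² · K)` — i.e. for
every curvature-regular `A` and EVERY direction `ψ`, `|D deficit(A)[ψ]| ≤ 2√(6(d+2)) n² K · n (Σ‖plaq ψ‖²)^{1/2}`.
In units (record §0 (l)): `δ = √(6(d+2)) · ξ_c · ‖∇F‖_{L²}` per plane, rate ONE COARSE SPACING — the `δ_k ∝ η`
of the wall's intended reading, for the LINEAR average. [folklore] -/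
theorem defectDerivBound_abelianModel (μ ν : Fin d) (K : ℝ) (hK : 0 ≤ K) :
    DefectDerivBound (critSet n M μ ν K) (dDeficit n M μ ν) (fineNorm n M μ ν)
      (2 * Real.sqrt (6 * (d + 2)) * (n : ℝ) ^ 2 * K) := by
  unfold DefectDerivBound
  intro A hA ψ
  rw [dDeficit_apply]
  have hmem : ∑ κ : Fin d, dE κ (plaq (fine n M) A μ ν) ≤ K ^ 2 := hA
  have hb := abs_bil_le_dE n M A ψ μ ν
  have hn : (0 : ℝ) ≤ (n : ℝ) := Nat.cast_nonneg n
  have hsq : Real.sqrt (6 * (d + 2) * (n : ℝ) ^ 4 * ∑ κ : Fin d, dE κ (plaq (fine n M) A μ ν))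
      ≤ Real.sqrt (6 * (d + 2)) * (n : ℝ) ^ 2 * K := by
    have h6 : (0 : ℝ) ≤ 6 * (d + 2) := by positivity
    calc Real.sqrt (6 * (d + 2) * (n : ℝ) ^ 4 * ∑ κ : Fin d, dE κ (plaq (fine n M) A μ ν))
        ≤ Real.sqrt (6 * (d + 2) * (n : ℝ) ^ 4 * K ^ 2) := by
          apply Real.sqrt_le_sqrt
          exact mul_le_mul_of_nonneg_left hmem (by positivity)
      _ = Real.sqrt (6 * (d + 2)) * (n : ℝ) ^ 2 * K := by
          rw [show 6 * ((d : ℝ) + 2) * (n : ℝ) ^ 4 * K ^ 2 = (6 * (d + 2)) * ((n : ℝ) ^ 2 * K) ^ 2 by ring,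
            Real.sqrt_mul h6, Real.sqrt_sq (by positivity)]
          ring
  have hF : 0 ≤ fineNorm n M μ ν ψ := by unfold fineNorm; positivity
  have habs : |2 * bil n M A ψ μ ν| = 2 * |bil n M A ψ μ ν| := by
    rw [abs_mul, abs_of_pos (by norm_num : (0:ℝ) < 2)]
  rw [habs]
  calc 2 * |bil n M A ψ μ ν|
      ≤ 2 * (Real.sqrt (6 * (d + 2) * (n : ℝ) ^ 4 * ∑ κ : Fin d, dE κ (plaq (fine n M) A μ ν))
          * fineNorm n M μ ν ψ) := by
        have := hb; unfold fineNorm; linarith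
    _ ≤ 2 * (Real.sqrt (6 * (d + 2)) * (n : ℝ) ^ 2 * K * fineNorm n M μ ν ψ) := by
        have := mul_le_mul_of_nonneg_right hsq hF
        linarith
    _ = 2 * Real.sqrt (6 * (d + 2)) * (n : ℝ) ^ 2 * K * fineNorm n M μ ν ψ := by ring

/-- The VALUE companion on the same set: `|deficit A| ≤ 6(d+2) n⁴ K²` for `A ∈ critSet K` — (β′) at model level
in the wall's vocabulary. [folklore] -/
theorem abs_deficit_le_of_mem_critSet (μ ν : Fin d) (K : ℝ) {A : Tor (fine n M) × Fin d → ℂ}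
    (hA : A ∈ critSet n M μ ν K) : |deficit n M A μ ν| ≤ 6 * (d + 2) * (n : ℝ) ^ 4 * K ^ 2 := by
  have h := abs_deficit_le' n M A μ ν
  have hmem : ∑ κ : Fin d, dE κ (plaq (fine n M) A μ ν) ≤ K ^ 2 := hA
  calc |deficit n M A μ ν| ≤ 6 * (d + 2) * (n : ℝ) ^ 4 * ∑ κ : Fin d, dE κ (plaq (fine n M) A μ ν) := h
    _ ≤ 6 * (d + 2) * (n : ℝ) ^ 4 * K ^ 2 := by
        exact mul_le_mul_of_nonneg_left hmem (by positivity)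

/-- GAUGE INVARIANCE of the instantiated functional in the field AND in the direction:
`D deficit(A − ∂λ)[ψ − ∂λ′] = D deficit(A)[ψ]` (B5 (1.4), (1.20); tree `bil_gaugeT`). [folklore] -/
theorem dDeficit_gaugeT (μ ν : Fin d) (A ψ : Tor (fine n M) × Fin d → ℂ) (lA lψ : Tor (fine n M) → ℂ) :
    dDeficit n M μ ν (gaugeT (fine n M) (n : ℂ) A lA) (gaugeT (fine n M) (n : ℂ) ψ lψ)
      = dDeficit n M μ ν A ψ := by
  rw [dDeficit_apply, dDeficit_apply, bil_gaugeT, bil_comm, bil_gaugeT, bil_comm]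

/-! ## §5 (v1.1) THE RIGHT INVERSE OF THE BLOCK AVERAGE, REUSED FROM THE TREE: the β sub-cell's face-layer lift
`Beta.FluctuationProjection.Jlift` (`(Jφ)(x, κ) = n φ(blockOf x, κ)` on the layer `digit_κ x = n − 1`, else `0`) with
its kernel theorem `QvOp_Jlift_mulVec : Q (J φ) = φ` (each straight contour of (1.18) meets the last layer of its own
block exactly once); here only its pointwise form at block points is added -/

/-- The face-layer lift at a block point: `(Jφ)(n·y + j, κ) = n φ(y, κ)` if `j_κ = n − 1`, else `0`. [folklore] -/
theorem Jlift_mulVec_bpt (φ : Tor M × Fin d → ℂ) (y : Tor M) (j : Fin d → Fin n) (κ : Fin d) :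
    (Jlift n M *ᵥ φ) (bpt n M y j, κ) = if ((j κ : ℕ) = n - 1) then (n : ℂ) * φ (y, κ) else 0 := by
  rw [Jlift_mulVec, digitOf_bpt, B5Blocks16.blockOf_bpt]

/-! ## §6 (v1.1) THE SIZE OF THE LIFT: `Σ_i ‖(Jφ)_i‖² ≤ n^{d+2} Σ_b ‖φ_b‖²` (exactly `n^{d+1}`: one layer of
`n^{d−1}` points per block and component, values `n φ`), `Σ_x ‖plaq ψ (x)‖² ≤ 16 Σ_i ‖ψ_i‖²`, hence the fine energy-type
norm of the lift is at most `4 n (n^{d+2})^{1/2}` times the coarse `ℓ²` norm -/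

/-- The coarse `ℓ²` norm of a coarse vector field. [folklore] -/
def coarseL2 (φ : Tor M × Fin d → ℂ) : ℝ := Real.sqrt (∑ b : Tor M × Fin d, ‖φ b‖ ^ 2)

/-- `0 ≤ ‖φ‖_{ℓ²}`. [folklore] -/
theorem coarseL2_nonneg (φ : Tor M × Fin d → ℂ) : 0 ≤ coarseL2 M φ := Real.sqrt_nonneg _

/-- `Σ_i ‖(Jφ)_i‖² ≤ n^{d+2} Σ_b ‖φ_b‖²`. [folklore] -/
theorem sum_normSq_Jlift_le (φ : Tor M × Fin d → ℂ) :
    ∑ i : Tor (fine n M) × Fin d, ‖(Jlift n M *ᵥ φ) i‖ ^ 2 ≤ (n : ℝ) ^ (d + 2) * ∑ b : Tor M × Fin d, ‖φ b‖ ^ 2 := by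
  have hpt : ∀ (y : Tor M) (j : Fin d → Fin n) (κ : Fin d),
      ‖(Jlift n M *ᵥ φ) (bpt n M y j, κ)‖ ^ 2 ≤ (n : ℝ) ^ 2 * ‖φ (y, κ)‖ ^ 2 := by
    intro y j κ
    rw [Jlift_mulVec_bpt]
    split_ifs
    · rw [norm_mul, Complex.norm_natCast, mul_pow]
    · simp only [norm_zero, ne_eq, OfNat.ofNat_ne_zero, not_false_eq_true, zero_pow]
      positivity
  calc ∑ i : Tor (fine n M) × Fin d, ‖(Jlift n M *ᵥ φ) i‖ ^ 2
      = ∑ κ : Fin d, ∑ x : Tor (fine n M), ‖(Jlift n M *ᵥ φ) (x, κ)‖ ^ 2 := by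
        rw [Fintype.sum_prod_type, Finset.sum_comm]
    _ = ∑ κ : Fin d, ∑ y : Tor M, ∑ j : Fin d → Fin n, ‖(Jlift n M *ᵥ φ) (bpt n M y j, κ)‖ ^ 2 := by
        refine Finset.sum_congr rfl fun κ _ => ?_
        exact sum_blocks_real n M (fun x => ‖(Jlift n M *ᵥ φ) (x, κ)‖ ^ 2)
    _ ≤ ∑ κ : Fin d, ∑ y : Tor M, ∑ j : Fin d → Fin n, (n : ℝ) ^ 2 * ‖φ (y, κ)‖ ^ 2 := by
        gcongr with κ _ y _ j _
        exact hpt y j κ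
    _ = ∑ κ : Fin d, ∑ y : Tor M, (n : ℝ) ^ (d + 2) * ‖φ (y, κ)‖ ^ 2 := by
        simp only [Finset.sum_const, Finset.card_univ, Fintype.card_pi, Fintype.card_fin, Finset.prod_const,
          nsmul_eq_mul]
        push_cast
        refine Finset.sum_congr rfl fun κ _ => Finset.sum_congr rfl fun y _ => ?_
        ring
    _ = (n : ℝ) ^ (d + 2) * ∑ b : Tor M × Fin d, ‖φ b‖ ^ 2 := by
        rw [Fintype.sum_prod_type, Finset.sum_comm, Finset.mul_sum]
        simp only [Finset.mul_sum]

omit [NeZero n] hM in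
/-- The plaquette sum of four bond values, squared: `‖plaq ψ μ ν (x)‖² ≤ 4 (‖ψ(x,μ)‖² + ‖ψ(x+e_μ,ν)‖² + ‖ψ(x+e_ν,μ)‖² +
‖ψ(x,ν)‖²)`. [folklore] -/
theorem normSq_plaq_le_four {N : Fin d → ℕ} (ψ : Tor N × Fin d → ℂ) (μ ν : Fin d) (x : Tor N) :
    ‖plaq N ψ μ ν x‖ ^ 2
      ≤ 4 * (‖ψ (x, μ)‖ ^ 2 + ‖ψ (x + unitVec N μ, ν)‖ ^ 2 + ‖ψ (x + unitVec N ν, μ)‖ ^ 2 + ‖ψ (x, ν)‖ ^ 2) := by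
  set a := ψ (x, μ)
  set b := ψ (x + unitVec N μ, ν)
  set c := ψ (x + unitVec N ν, μ)
  set e := ψ (x, ν)
  have hplaq : plaq N ψ μ ν x = a + b - c - e := rfl
  have h1 : ‖a + b - c - e‖ ≤ ‖a‖ + ‖b‖ + ‖c‖ + ‖e‖ := by
    calc ‖a + b - c - e‖ ≤ ‖a + b - c‖ + ‖e‖ := norm_sub_le _ _
      _ ≤ ‖a + b‖ + ‖c‖ + ‖e‖ := by gcongr; exact norm_sub_le _ _
      _ ≤ ‖a‖ + ‖b‖ + ‖c‖ + ‖e‖ := by gcongr; exact norm_add_le _ _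
  have h0 : 0 ≤ ‖a + b - c - e‖ := norm_nonneg _
  rw [hplaq]
  calc ‖a + b - c - e‖ ^ 2 ≤ (‖a‖ + ‖b‖ + ‖c‖ + ‖e‖) ^ 2 := by gcongr
    _ ≤ 4 * (‖a‖ ^ 2 + ‖b‖ ^ 2 + ‖c‖ ^ 2 + ‖e‖ ^ 2) := by
        nlinarith [sq_nonneg (‖a‖ - ‖b‖), sq_nonneg (‖a‖ - ‖c‖), sq_nonneg (‖a‖ - ‖e‖),
          sq_nonneg (‖b‖ - ‖c‖), sq_nonneg (‖b‖ - ‖e‖), sq_nonneg (‖c‖ - ‖e‖)]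

omit [NeZero n] hM in
/-- One component's `ℓ²` mass is at most the whole field's. [folklore] -/
theorem sum_normSq_comp_le {N : Fin d → ℕ} [∀ μ, NeZero (N μ)] (ψ : Tor N × Fin d → ℂ) (κ : Fin d) :
    ∑ x : Tor N, ‖ψ (x, κ)‖ ^ 2 ≤ ∑ i : Tor N × Fin d, ‖ψ i‖ ^ 2 := by
  rw [Fintype.sum_prod_type]
  exact Finset.sum_le_sum fun x _ =>
    Finset.single_le_sum (f := fun κ' => ‖ψ (x, κ')‖ ^ 2) (fun _ _ => by positivity) (Finset.mem_univ κ)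

omit [NeZero n] hM in
/-- The plaquette sum is `ℓ²`-bounded by the field: `Σ_x ‖plaq ψ μ ν (x)‖² ≤ 16 Σ_i ‖ψ_i‖²`. [folklore] -/
theorem sum_normSq_plaq_le {N : Fin d → ℕ} [∀ μ, NeZero (N μ)] (ψ : Tor N × Fin d → ℂ) (μ ν : Fin d) :
    ∑ x : Tor N, ‖plaq N ψ μ ν x‖ ^ 2 ≤ 16 * ∑ i : Tor N × Fin d, ‖ψ i‖ ^ 2 := by
  have hμ := sum_normSq_comp_le ψ μ
  have hν := sum_normSq_comp_le ψ ν
  have htμ : ∑ x : Tor N, ‖ψ (x + unitVec N μ, ν)‖ ^ 2 = ∑ x : Tor N, ‖ψ (x, ν)‖ ^ 2 :=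
    Equiv.sum_comp (Equiv.addRight (unitVec N μ)) (fun x => ‖ψ (x, ν)‖ ^ 2)
  have htν : ∑ x : Tor N, ‖ψ (x + unitVec N ν, μ)‖ ^ 2 = ∑ x : Tor N, ‖ψ (x, μ)‖ ^ 2 :=
    Equiv.sum_comp (Equiv.addRight (unitVec N ν)) (fun x => ‖ψ (x, μ)‖ ^ 2)
  calc ∑ x : Tor N, ‖plaq N ψ μ ν x‖ ^ 2
      ≤ ∑ x : Tor N, 4 * (‖ψ (x, μ)‖ ^ 2 + ‖ψ (x + unitVec N μ, ν)‖ ^ 2 + ‖ψ (x + unitVec N ν, μ)‖ ^ 2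
          + ‖ψ (x, ν)‖ ^ 2) := Finset.sum_le_sum fun x _ => normSq_plaq_le_four ψ μ ν x
    _ = 4 * (∑ x : Tor N, ‖ψ (x, μ)‖ ^ 2 + ∑ x : Tor N, ‖ψ (x + unitVec N μ, ν)‖ ^ 2
          + ∑ x : Tor N, ‖ψ (x + unitVec N ν, μ)‖ ^ 2 + ∑ x : Tor N, ‖ψ (x, ν)‖ ^ 2) := by
        rw [← Finset.mul_sum]
        simp only [Finset.sum_add_distrib]
    _ = 4 * (∑ x : Tor N, ‖ψ (x, μ)‖ ^ 2 + ∑ x : Tor N, ‖ψ (x, ν)‖ ^ 2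
          + ∑ x : Tor N, ‖ψ (x, μ)‖ ^ 2 + ∑ x : Tor N, ‖ψ (x, ν)‖ ^ 2) := by rw [htμ, htν]
    _ ≤ 4 * (∑ i : Tor N × Fin d, ‖ψ i‖ ^ 2 + ∑ i : Tor N × Fin d, ‖ψ i‖ ^ 2
          + ∑ i : Tor N × Fin d, ‖ψ i‖ ^ 2 + ∑ i : Tor N × Fin d, ‖ψ i‖ ^ 2) := by gcongr
    _ = 16 * ∑ i : Tor N × Fin d, ‖ψ i‖ ^ 2 := by ring

/-- THE LIFT CONSTANT: `fineNorm μ ν (J φ) ≤ 4 n (n^{d+2})^{1/2} ‖φ‖_{ℓ²}`. [folklore] -/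
theorem fineNorm_Jlift_le (μ ν : Fin d) (φ : Tor M × Fin d → ℂ) :
    fineNorm n M μ ν (Jlift n M *ᵥ φ) ≤ 4 * (n : ℝ) * Real.sqrt ((n : ℝ) ^ (d + 2)) * coarseL2 M φ := by
  have hn : (0 : ℝ) ≤ n := Nat.cast_nonneg n
  have h1 : ∑ x : Tor (fine n M), ‖plaq (fine n M) (Jlift n M *ᵥ φ) μ ν x‖ ^ 2
      ≤ 16 * ((n : ℝ) ^ (d + 2) * ∑ b : Tor M × Fin d, ‖φ b‖ ^ 2) :=
    (sum_normSq_plaq_le (Jlift n M *ᵥ φ) μ ν).trans (by gcongr; exact sum_normSq_Jlift_le n M φ)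
  have h2 : Real.sqrt (∑ x : Tor (fine n M), ‖plaq (fine n M) (Jlift n M *ᵥ φ) μ ν x‖ ^ 2)
      ≤ 4 * Real.sqrt ((n : ℝ) ^ (d + 2)) * coarseL2 M φ := by
    calc Real.sqrt (∑ x : Tor (fine n M), ‖plaq (fine n M) (Jlift n M *ᵥ φ) μ ν x‖ ^ 2)
        ≤ Real.sqrt (16 * ((n : ℝ) ^ (d + 2) * ∑ b : Tor M × Fin d, ‖φ b‖ ^ 2)) := Real.sqrt_le_sqrt h1
      _ = Real.sqrt 16 * (Real.sqrt ((n : ℝ) ^ (d + 2)) * coarseL2 M φ) := by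
          rw [Real.sqrt_mul (by norm_num), Real.sqrt_mul (by positivity), coarseL2]
      _ = 4 * Real.sqrt ((n : ℝ) ^ (d + 2)) * coarseL2 M φ := by
          rw [show (16 : ℝ) = 4 ^ 2 by norm_num, Real.sqrt_sq (by norm_num)]; ring
  unfold fineNorm
  calc (n : ℝ) * Real.sqrt (∑ x : Tor (fine n M), ‖plaq (fine n M) (Jlift n M *ᵥ φ) μ ν x‖ ^ 2)
      ≤ (n : ℝ) * (4 * Real.sqrt ((n : ℝ) ^ (d + 2)) * coarseL2 M φ) := mul_le_mul_of_nonneg_left h2 hn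
    _ = _ := by ring

/-! ## §7 (v1.1) THE SECOND TYPED SHAPE `T4ConvexResponse.TangentLift` INHABITED BY THE ABELIAN MODEL, and the
model instance of the wall's consumer `dualResidual_le` (R2ᴱ): averages of fine fields that are critical for the
fine quadratic action among directions with block average in `T` are coarse-critical on `T` up to a dual-norm
residual `≤ Λ · δ · ‖φ‖_{ℓ²}`, `Λ = 4n (n^{d+2})^{1/2}`, `δ = 2√(6(d+2)) n² K` -/

/-- The block average (1.18) as a real-linear map (it is complex-linear; only real-linearity is used). [folklore] -/
def dQ : (Tor (fine n M) × Fin d → ℂ) →ₗ[ℝ] (Tor M × Fin d → ℂ) where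
  toFun ψ := QvOp n M *ᵥ ψ
  map_add' ψ ψ' := Matrix.mulVec_add _ _ _
  map_smul' r ψ := by
    simp only [RingHom.id_apply]
    rw [real_smul_eq, real_smul_eq, Matrix.mulVec_smul]

/-- Unfolding lemma. [folklore] -/
theorem dQ_apply (ψ : Tor (fine n M) × Fin d → ℂ) : dQ n M ψ = QvOp n M *ᵥ ψ := rfl

/-- `TangentLift` INHABITED: for EVERY set of fine fields `crit`, EVERY set of coarse directions `T` and every plane,
with the fine tangency condition «the block average of `ψ` lies in `T`» (the form the composition law
`Q_{k+1} = Q ∘ Q_k` of (1.18) gives to constraints imposed through further averaging), the derivative of the average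
`dQ` (the average is linear), the fine energy-type norm `fineNorm μ ν`, the coarse `ℓ²` norm and
`Λ = 4 n (n^{d+2})^{1/2}`: the face-layer lift `J φ` of `Beta.FluctuationProjection` is the witness (`Q(Jφ) = φ`, so it
is tangent as soon as `φ ∈ T`).
`Λ` depends on `d` and on the FIXED block size `n = L` only. [folklore] -/
theorem tangentLift_abelianModel (crit : Set (Tor (fine n M) × Fin d → ℂ)) (T : Set (Tor M × Fin d → ℂ))
    (μ ν : Fin d) :
    TangentLift crit T (fun _ ψ => QvOp n M *ᵥ ψ ∈ T) (fun _ => dQ n M) (fineNorm n M μ ν) (coarseL2 M)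
      (4 * (n : ℝ) * Real.sqrt ((n : ℝ) ^ (d + 2))) := by
  intro u _ φ hφ
  refine ⟨Jlift n M *ᵥ φ, ?_, ?_, fineNorm_Jlift_le n M μ ν φ⟩
  · show QvOp n M *ᵥ (Jlift n M *ᵥ φ) ∈ T
    rw [QvOp_Jlift_mulVec]; exact hφ
  · rw [dQ_apply, QvOp_Jlift_mulVec]

/-- The COARSE quadratic (Wilson-type, abelian) action of the plane `(μ, ν)` in the normalisation of `deficit`:
`n^d Σ_y ‖plaq_M B (y)‖²`. [folklore] -/
def actC (μ ν : Fin d) (B : Tor M × Fin d → ℂ) : ℝ := (n : ℝ) ^ d * ∑ y : Tor M, ‖plaq M B μ ν y‖ ^ 2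

/-- The FINE quadratic action of the plane `(μ, ν)` in the normalisation of `deficit`: `n² Σ_x ‖plaq A (x)‖²`. [folklore] -/
def actF (μ ν : Fin d) (A : Tor (fine n M) × Fin d → ℂ) : ℝ :=
  (n : ℝ) ^ 2 * ∑ x : Tor (fine n M), ‖plaq (fine n M) A μ ν x‖ ^ 2

/-- `deficit A = actC (Q A) − actF A` (definitional). [folklore] -/
theorem deficit_eq_actC_sub_actF (μ ν : Fin d) (A : Tor (fine n M) × Fin d → ℂ) :
    deficit n M A μ ν = actC n M μ ν (QvOp n M *ᵥ A) - actF n M μ ν A := rfl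

/-- The first variation of the coarse action at `B`: `φ ↦ 2 n^d Σ_y Re⟨plaq B, plaq φ⟩`. [folklore] -/
def dActC (μ ν : Fin d) (B : Tor M × Fin d → ℂ) : (Tor M × Fin d → ℂ) →ₗ[ℝ] ℝ where
  toFun φ := 2 * (n : ℝ) ^ d * ∑ y : Tor M, rin (plaq M B μ ν y) (plaq M φ μ ν y)
  map_add' φ φ' := by
    simp only [plaq_add, rin_add_right, Finset.sum_add_distrib]; ring
  map_smul' r φ := by
    simp only [plaq_real_smul, rin_smul_right, ← Finset.mul_sum, RingHom.id_apply, smul_eq_mul]; ring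

/-- The first variation of the fine action at `A`: `ψ ↦ 2 n² Σ_x Re⟨plaq A, plaq ψ⟩`. [folklore] -/
def dActF (μ ν : Fin d) (A : Tor (fine n M) × Fin d → ℂ) : (Tor (fine n M) × Fin d → ℂ) →ₗ[ℝ] ℝ where
  toFun ψ := 2 * (n : ℝ) ^ 2 * ∑ x : Tor (fine n M), rin (plaq (fine n M) A μ ν x) (plaq (fine n M) ψ μ ν x)
  map_add' ψ ψ' := by
    simp only [plaq_add, rin_add_right, Finset.sum_add_distrib]; ring
  map_smul' r ψ := by
    simp only [plaq_real_smul, rin_smul_right, ← Finset.mul_sum, RingHom.id_apply, smul_eq_mul]; ring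

omit [NeZero n] in
/-- Unfolding lemma. [folklore] -/
theorem dActC_apply (μ ν : Fin d) (B φ : Tor M × Fin d → ℂ) :
    dActC n M μ ν B φ = 2 * (n : ℝ) ^ d * ∑ y : Tor M, rin (plaq M B μ ν y) (plaq M φ μ ν y) := rfl

/-- Unfolding lemma. [folklore] -/
theorem dActF_apply (μ ν : Fin d) (A ψ : Tor (fine n M) × Fin d → ℂ) :
    dActF n M μ ν A ψ
      = 2 * (n : ℝ) ^ 2 * ∑ x : Tor (fine n M), rin (plaq (fine n M) A μ ν x) (plaq (fine n M) ψ μ ν x) := rfl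

/-- `dActF` IS the derivative of the fine action: `s ↦ actF(A + sψ)` has derivative `dActF A ψ` at `0`. [folklore] -/
theorem hasDerivAt_actF (μ ν : Fin d) (A ψ : Tor (fine n M) × Fin d → ℂ) :
    HasDerivAt (fun s : ℝ => actF n M μ ν (A + (s : ℂ) • ψ)) (dActF n M μ ν A ψ) 0 := by
  have hfun : (fun s : ℝ => actF n M μ ν (A + (s : ℂ) • ψ))
      = fun s : ℝ => actF n M μ ν A + dActF n M μ ν A ψ * s + actF n M μ ν ψ * s ^ 2 := by
    funext s
    simp only [actF, dActF_apply, plaq_add_smul, normSq_add_smul, Finset.sum_add_distrib, ← Finset.mul_sum]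
    ring
  rw [hfun]
  have ha := (hasDerivAt_id (0 : ℝ)).const_mul (dActF n M μ ν A ψ)
  have hb := (hasDerivAt_pow 2 (0 : ℝ)).const_mul (actF n M μ ν ψ)
  have h := (ha.const_add (actF n M μ ν A)).add hb
  simpa [Pi.add_def] using h

omit [NeZero n] hM in
/-- `plaq_M` of `B + s φ`, pointwise (coarse copy of `plaq_add_smul`). [folklore] -/
theorem plaq_add_smul_coarse (B φ : Tor M × Fin d → ℂ) (s : ℝ) (μ ν : Fin d) (y : Tor M) :
    plaq M (B + (s : ℂ) • φ) μ ν y = plaq M B μ ν y + (s : ℂ) * plaq M φ μ ν y := by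
  simp only [plaq, Pi.add_apply, Pi.smul_apply, smul_eq_mul]; ring

omit [NeZero n] in
/-- `dActC` IS the derivative of the coarse action: `s ↦ actC(B + sφ)` has derivative `dActC B φ` at `0`. [folklore] -/
theorem hasDerivAt_actC (μ ν : Fin d) (B φ : Tor M × Fin d → ℂ) :
    HasDerivAt (fun s : ℝ => actC n M μ ν (B + (s : ℂ) • φ)) (dActC n M μ ν B φ) 0 := by
  have hfun : (fun s : ℝ => actC n M μ ν (B + (s : ℂ) • φ))
      = fun s : ℝ => actC n M μ ν B + dActC n M μ ν B φ * s + actC n M μ ν φ * s ^ 2 := by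
    funext s
    simp only [actC, dActC_apply, plaq_add_smul_coarse, normSq_add_smul, Finset.sum_add_distrib, ← Finset.mul_sum]
    ring
  rw [hfun]
  have ha := (hasDerivAt_id (0 : ℝ)).const_mul (dActC n M μ ν B φ)
  have hb := (hasDerivAt_pow 2 (0 : ℝ)).const_mul (actC n M μ ν φ)
  have h := (ha.const_add (actC n M μ ν B)).add hb
  simpa [Pi.add_def] using h

/-- THE CHAIN RULE of the wall's consumer, as an identity of the model: `D deficit(u)[ψ] = D actC(Q u)[Q ψ] − D actF(u)[ψ]`.
[folklore] -/
theorem dDeficit_eq_chain (μ ν : Fin d) (u ψ : Tor (fine n M) × Fin d → ℂ) :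
    dDeficit n M μ ν u ψ = dActC n M μ ν (QvOp n M *ᵥ u) (dQ n M ψ) - dActF n M μ ν u ψ := by
  rw [dDeficit_apply, dActC_apply, dActF_apply, dQ_apply, bil]
  ring

omit [NeZero n] hM in
/-- `DefectDerivBound` is monotone in the set of fields. [folklore] -/
theorem defectDerivBound_mono {F : Type*} [AddCommGroup F] [Module ℝ F] {crit crit' : Set F}
    {d𝓓 : F → F →ₗ[ℝ] ℝ} {normF : F → ℝ} {δ : ℝ} (h : crit' ⊆ crit) (hdef : DefectDerivBound crit d𝓓 normF δ) :
    DefectDerivBound crit' d𝓓 normF δ :=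
  fun u hu ψ => hdef u (h hu) ψ

/-- R2ᴱ OF THE LINEAGE, ABELIAN MODEL, END TO END (the wall's consumer `T4ConvexResponse.dualResidual_le` with ALL
FOUR of its hypotheses discharged by theorems of this package: the chain rule `dDeficit_eq_chain`, the lift
`tangentLift_abelianModel`, the defect bound `defectDerivBound_abelianModel`, and fine criticality as the only
assumption on `u`).  Let `T` be any set of coarse directions and `u` a fine field of the plane-`(μ, ν)`
curvature-regular set at level `K` (`Σ_κ E_κ(plaq u) ≤ K²`) that is CRITICAL FOR THE FINE ACTION `actF` AMONG ALL
FINE DIRECTIONS WHOSE BLOCK AVERAGE LIES IN `T`.  Then its block average `Q u` is critical for the COARSE action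
`actC` on `T` up to the dual-norm residual `|D actC(Q u)[φ]| ≤ Λ δ ‖φ‖_{ℓ²}`, `Λ = 4n(n^{d+2})^{1/2}`,
`δ = 2√(6(d+2)) n² K` — first order in the curvature-gradient level `K`, constants depending on `d` and the fixed
block size only.  (Reading, record §0 (o): «one averaging step moves constrained fine critical points to almost
coarse-critical points, with a defect of one coarse spacing times the curvature gradient» — the η-rate mechanism of
NE3 in the linear abelian model; nothing about Bałaban's non-linear average, his minimisers or NE3 itself.) [folklore] -/
theorem dualResidual_abelianModel (μ ν : Fin d) (K : ℝ) (hK : 0 ≤ K) (T : Set (Tor M × Fin d → ℂ))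
    {u : Tor (fine n M) × Fin d → ℂ} (hu : u ∈ critSet n M μ ν K)
    (hcrit : ∀ ψ : Tor (fine n M) × Fin d → ℂ, QvOp n M *ᵥ ψ ∈ T → dActF n M μ ν u ψ = 0)
    {φ : Tor M × Fin d → ℂ} (hφ : φ ∈ T) :
    |dActC n M μ ν (QvOp n M *ᵥ u) φ|
      ≤ (4 * (n : ℝ) * Real.sqrt ((n : ℝ) ^ (d + 2))) * (2 * Real.sqrt (6 * ((d : ℝ) + 2)) * (n : ℝ) ^ 2 * K)
          * coarseL2 M φ := by
  let crit : Set (Tor (fine n M) × Fin d → ℂ) :=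
    {v | v ∈ critSet n M μ ν K ∧ ∀ ψ : Tor (fine n M) × Fin d → ℂ, QvOp n M *ᵥ ψ ∈ T → dActF n M μ ν v ψ = 0}
  have hsub : crit ⊆ critSet n M μ ν K := fun v hv => hv.1
  have hu' : u ∈ crit := ⟨hu, hcrit⟩
  have hdef : DefectDerivBound crit (dDeficit n M μ ν) (fineNorm n M μ ν)
      (2 * Real.sqrt (6 * ((d : ℝ) + 2)) * (n : ℝ) ^ 2 * K) :=
    defectDerivBound_mono hsub (defectDerivBound_abelianModel n M μ ν K hK)
  have hδ : 0 ≤ 2 * Real.sqrt (6 * ((d : ℝ) + 2)) * (n : ℝ) ^ 2 * K := by positivity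
  exact dualResidual_le (crit := crit) (T := T) (fineT := fun _ ψ => QvOp n M *ᵥ ψ ∈ T) (dActC n M μ ν)
    (dActF n M μ ν) (fun v => QvOp n M *ᵥ v) (fun _ => dQ n M) (dDeficit n M μ ν)
    (fun v ψ => dDeficit_eq_chain n M μ ν v ψ) (fun v hv ψ hψ => hv.2 ψ hψ)
    (tangentLift_abelianModel n M crit T μ ν) hdef hδ hu' hφ

/-- NON-VACUITY of the hypotheses of `dualResidual_abelianModel`: the zero field lies in every `critSet K` (`K ≥ 0`,
`zero_mem_critSet`) and is critical for the fine action in every direction. [folklore] -/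
theorem dActF_zero (μ ν : Fin d) (ψ : Tor (fine n M) × Fin d → ℂ) :
    dActF n M μ ν (0 : Tor (fine n M) × Fin d → ℂ) ψ = 0 := by
  rw [dActF_apply]
  have h0 : ∀ x : Tor (fine n M), plaq (fine n M) (0 : Tor (fine n M) × Fin d → ℂ) μ ν x = 0 := by
    intro x; simp [plaq]
  simp [h0, rin]

end

end Literature.MathematicalPhysics.QuantumFieldTheory.Balaban1983to89.T4AveragingDeficitBridge
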